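import Mathlib
import HarnessLib
import Literature.MathematicalPhysics.StatisticalMechanics.LennardJonesClusters
import Summits.AtomisticToContinuum.Crystallization.Theorems.ContactSaturationLadderWindowFloor
import Summits.AtomisticToContinuum.Crystallization.Theorems.ContactSaturationLadderWindowCeiling
import Summits.AtomisticToContinuum.Crystallization.Theorems.ContactSaturationLadderDilationCharge

/-!
# ContactSaturationLadder · `LooseTextureRung` (stmt-AtomisticToContinuum-30303) — the EXCESS SPLIT (localisation of window laws)

Helper module for the crux `Summit.AtomisticToContinuum.Crystallization.Theses.ContactSaturationLadder.LooseTextureRung`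
(skeleton v6.3 «DialFreeSieveV6», stub `stub_corelessLaw6` = the coreless law CL; decomp-a2c lens-1 g26, the LOCALISATION tool of the
strain-mode ladder beneath CL).  Every rung of that ladder prices a window `W` through charges carried by SUB-windows (balls of a smaller
radius around the loose texture); this file is the bookkeeping that turns per-sub-window charges into a window law, with the cut cost
named and, at GS grade, bounded.

## What is proved

Notation (prose only): `𝓔(y|W) = ½ Σ_{i∈W} Σ_{k∈W∖{i}} V_LJ(|y_i − y_k|)` (internal energy of the index set `W`), `e⋆ = ⨅_Q e(Q)`,
`X(y|W) = 𝓔(y|W) − #W·e⋆` (window excess, `≥ 0` for distinct points), `N(P) = Σ_{i∈P} Σ_{k∉P} V_LJ⁻(|y_i − y_k|)` (attractive cross mass of `P`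
with its complement, `V⁻ = max(0, −V)`), `S_n(W) = Σ_{i∈W}Σ_{k∈W∖{i}} |y_i − y_k|⁻ⁿ`.

* §1 `sum_erase_split`, `sum_erase_split_symm` — the split of an ordered-pair double sum over `W` along `P ⊆ W` (any kernel; symmetric
  kernel: `D(W) = D(P) + D(W∖P) + 2·Σ_{P×(W∖P)}`); `half_sum_lennardJones_split` for the Lennard-Jones window energy.
* §2 `windowExcess_split` — ONE-STEP EXCESS SPLIT (injective grade, no ground state needed):
      `X(y|P) + X(y|W∖P) − N(P) ≤ X(y|W)`   for every `P ⊆ W`;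
  `windowExcess_superadditive` — for every finite family `(P_j)_{j∈s}` of pairwise disjoint index sets inside `W`:
      `Σ_j X(y|P_j) − Σ_j N(P_j) ≤ X(y|W)`   (induction on `s`, the remainder's excess dropped by the floor).
* §3 GS GRADE — `gsSubBalls_superadditive`: with the tree's attractive cross ceiling `ContactSaturationLadderWindowCeiling.crossNeg_le`
  (`N(B(q,r)) ≤ D·r²` for balls of a ground state, `r ≥ 9`): for every family of centres `s` whose `r`-balls are pairwise disjoint (as index
  sets) and lie in `W`,   `Σ_{q∈s} X(y|B(q,r)) − #s·D·r² ≤ X(y|W)`.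
* §4 GS GRADE — `gsUnbalancedBalls_pay`: combined with the dilation charge (`ContactSaturationLadderDilationCharge.virial_sq_le_of_separated`)
  and the uniform minimal distance of ground states: for every `η > 0` there are `c > 0` and `D` such that for `r ≥ 9`, every ground state,
  every `W` and every such family of `η`-UNBALANCED balls (`η·#B(q,r) ≤ |S₁₂(B(q,r)) − S₆(B(q,r))|`),
      `c·Σ_{q∈s} #B(q,r) − #s·D·r² ≤ X(y|W)`:
  MESOSCOPICALLY DILATED (virial-unbalanced) BULK PAYS in proportion to its mass, at the cut cost `D·r²` per ball.

## Scope (honest)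
The cut cost `N(P)` is the only loss of localisation and it is of SURFACE order for balls of a ground state (§3); hence charges of order
`#B(q,r) ∼ r³` on sub-balls survive localisation for `r` large against `D`, charges of order `r²` or less do not.  §4 is the dilatation-mode
instance; the node's later rungs (affine / chart charges) are meant to be fed through §2–§3 in the same way.  On large GS sub-balls the
dilatation charge is void by local zero pressure (`ContactSaturationLadderDilationCharge.gsWindowVirial_small`), so §4 bites at mesoscopic
radii only; whether such unbalanced mesoscopic balls occur near coreless loose textures of ground states is exactly what CL asks.
-/

namespace Summit.AtomisticToContinuum.Crystallization.Theorems.ContactSaturationLadderExcessSplit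

open scoped BigOperators Classical
open Literature.MathematicalPhysics.StatisticalMechanics (lennardJones IsGroundState PeriodicConfiguration
  LennardJonesMinimalDistance_holds)
open Summit.AtomisticToContinuum.Crystallization.Theorems.ContactSaturationLadderWindowFloor (card_mul_iInf_le_half_sum)
open Summit.AtomisticToContinuum.Crystallization.Theorems.ContactSaturationLadderDilationCharge (windowExcess_nonneg
  virial_sq_le_of_separated)

/-! ## §1 Splitting an ordered-pair double sum along a sub-index-set -/

/-- **Double-sum split along `P ⊆ W`** (any kernel):
`Σ_{i∈W}Σ_{k∈W∖i} f = Σ_{P}Σ_{P∖i} f + Σ_{W∖P}Σ_{(W∖P)∖i} f + Σ_{i∈P}Σ_{k∈W∖P} f + Σ_{i∈W∖P}Σ_{k∈P} f`. -/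
theorem sum_erase_split {N : ℕ} (f : Fin N → Fin N → ℝ) {W P : Finset (Fin N)} (hPW : P ⊆ W) :
    ∑ i ∈ W, ∑ k ∈ W.erase i, f i k =
      (∑ i ∈ P, ∑ k ∈ P.erase i, f i k) + (∑ i ∈ W \ P, ∑ k ∈ (W \ P).erase i, f i k)
        + (∑ i ∈ P, ∑ k ∈ W \ P, f i k) + (∑ i ∈ W \ P, ∑ k ∈ P, f i k) := by
  rw [← Finset.sum_sdiff hPW]
  have hP : ∀ i ∈ P, ∑ k ∈ W.erase i, f i k = ∑ k ∈ P.erase i, f i k + ∑ k ∈ W \ P, f i k := by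
    intro i hi
    have hsub : P.erase i ⊆ W.erase i := Finset.erase_subset_erase i hPW
    rw [← Finset.sum_sdiff hsub, add_comm]
    congr 1
    refine Finset.sum_congr ?_ fun _ _ => rfl
    ext k
    simp only [Finset.mem_sdiff, Finset.mem_erase]
    constructor
    · rintro ⟨⟨hki, hkW⟩, hk⟩
      exact ⟨hkW, fun hkP => hk ⟨hki, hkP⟩⟩
    · rintro ⟨hkW, hkP⟩
      refine ⟨⟨fun h => hkP ?_, hkW⟩, fun h => hkP h.2⟩
      rw [h]
      exact hi
  have hR : ∀ i ∈ W \ P, ∑ k ∈ W.erase i, f i k = ∑ k ∈ (W \ P).erase i, f i k + ∑ k ∈ P, f i k := by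
    intro i hi
    have hiP : i ∉ P := (Finset.mem_sdiff.1 hi).2
    have hsub : P ⊆ W.erase i := by
      intro k hk
      refine Finset.mem_erase.2 ⟨fun h => hiP ?_, hPW hk⟩
      rw [← h]
      exact hk
    rw [← Finset.sum_sdiff hsub]
    congr 1
    refine Finset.sum_congr ?_ fun _ _ => rfl
    ext k
    simp only [Finset.mem_sdiff, Finset.mem_erase]
    constructor
    · rintro ⟨⟨hki, hkW⟩, hkP⟩
      exact ⟨hki, hkW, hkP⟩
    · rintro ⟨hki, hkW, hkP⟩
      exact ⟨⟨hki, hkW⟩, hkP⟩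
  rw [Finset.sum_congr rfl hP, Finset.sum_congr rfl hR, Finset.sum_add_distrib, Finset.sum_add_distrib]
  ring

/-- Symmetric kernel: the two cross blocks agree, `D(W) = D(P) + D(W∖P) + 2·Σ_{i∈P}Σ_{k∈W∖P} f`. -/
theorem sum_erase_split_symm {N : ℕ} (f : Fin N → Fin N → ℝ) (hf : ∀ i k, f i k = f k i) {W P : Finset (Fin N)}
    (hPW : P ⊆ W) :
    ∑ i ∈ W, ∑ k ∈ W.erase i, f i k =
      (∑ i ∈ P, ∑ k ∈ P.erase i, f i k) + (∑ i ∈ W \ P, ∑ k ∈ (W \ P).erase i, f i k)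
        + 2 * ∑ i ∈ P, ∑ k ∈ W \ P, f i k := by
  rw [sum_erase_split f hPW]
  have h : ∑ i ∈ W \ P, ∑ k ∈ P, f i k = ∑ i ∈ P, ∑ k ∈ W \ P, f i k := by
    rw [Finset.sum_comm]
    exact Finset.sum_congr rfl fun i _ => Finset.sum_congr rfl fun k _ => hf k i
  rw [h]
  ring

/-- **The window energy splits**: `𝓔(y|W) = 𝓔(y|P) + 𝓔(y|W∖P) + Σ_{i∈P}Σ_{k∈W∖P} V_LJ(|y_i − y_k|)` for `P ⊆ W`. -/
theorem half_sum_lennardJones_split {N : ℕ} (y : Fin N → EuclideanSpace ℝ (Fin 3)) {W P : Finset (Fin N)} (hPW : P ⊆ W) :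
    (1 / 2) * ∑ i ∈ W, ∑ k ∈ W.erase i, lennardJones (dist (y i) (y k)) =
      (1 / 2) * ∑ i ∈ P, ∑ k ∈ P.erase i, lennardJones (dist (y i) (y k)) +
        (1 / 2) * ∑ i ∈ W \ P, ∑ k ∈ (W \ P).erase i, lennardJones (dist (y i) (y k)) +
          ∑ i ∈ P, ∑ k ∈ W \ P, lennardJones (dist (y i) (y k)) := by
  have h := sum_erase_split_symm (fun i k : Fin N => lennardJones (dist (y i) (y k)))
    (fun i k => by rw [dist_comm]) hPW
  beta_reduce at h
  rw [h]
  ring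

/-! ## §2 The excess split (injective grade) -/

/-- The cross block is at least minus the attractive cross mass of `P` with its whole complement:
`−N(P) ≤ Σ_{i∈P}Σ_{k∈W∖P} V_LJ`. -/
theorem neg_crossNeg_le_cross {N : ℕ} (y : Fin N → EuclideanSpace ℝ (Fin 3)) (W P : Finset (Fin N)) :
    -(∑ i ∈ P, ∑ k ∈ Pᶜ, max 0 (-lennardJones (dist (y i) (y k)))) ≤
      ∑ i ∈ P, ∑ k ∈ W \ P, lennardJones (dist (y i) (y k)) := by
  have h1 : ∑ i ∈ P, ∑ k ∈ W \ P, max 0 (-lennardJones (dist (y i) (y k))) ≤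
      ∑ i ∈ P, ∑ k ∈ Pᶜ, max 0 (-lennardJones (dist (y i) (y k))) :=
    Finset.sum_le_sum fun i _ =>
      Finset.sum_le_sum_of_subset_of_nonneg (fun k hk => Finset.mem_compl.2 (Finset.mem_sdiff.1 hk).2)
        fun _ _ _ => le_max_left _ _
  have h2 : -(∑ i ∈ P, ∑ k ∈ W \ P, max 0 (-lennardJones (dist (y i) (y k)))) ≤
      ∑ i ∈ P, ∑ k ∈ W \ P, lennardJones (dist (y i) (y k)) := by
    rw [← Finset.sum_neg_distrib]
    refine Finset.sum_le_sum fun i _ => ?_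
    rw [← Finset.sum_neg_distrib]
    refine Finset.sum_le_sum fun k _ => ?_
    have := le_max_right (0 : ℝ) (-lennardJones (dist (y i) (y k)))
    linarith
  linarith

/-- **ONE-STEP EXCESS SPLIT** (injective grade): for distinct points and `P ⊆ W`,
`X(y|P) + X(y|W∖P) − N(P) ≤ X(y|W)` — the window excess dominates the excesses of the part and of the remainder, up to the attractive
cross mass of the part. -/
theorem windowExcess_split {N : ℕ} (y : Fin N → EuclideanSpace ℝ (Fin 3)) {W P : Finset (Fin N)} (hPW : P ⊆ W) :
    ((1 / 2) * ∑ i ∈ P, ∑ k ∈ P.erase i, lennardJones (dist (y i) (y k)) -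
        (P.card : ℝ) * (⨅ Q : PeriodicConfiguration 3, Q.energyPerParticle lennardJones)) +
      ((1 / 2) * ∑ i ∈ W \ P, ∑ k ∈ (W \ P).erase i, lennardJones (dist (y i) (y k)) -
        ((W \ P).card : ℝ) * (⨅ Q : PeriodicConfiguration 3, Q.energyPerParticle lennardJones)) -
      ∑ i ∈ P, ∑ k ∈ Pᶜ, max 0 (-lennardJones (dist (y i) (y k))) ≤
    (1 / 2) * ∑ i ∈ W, ∑ k ∈ W.erase i, lennardJones (dist (y i) (y k)) -
      (W.card : ℝ) * (⨅ Q : PeriodicConfiguration 3, Q.energyPerParticle lennardJones) := by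
  have hsplit := half_sum_lennardJones_split y hPW
  have hcross := neg_crossNeg_le_cross y W P
  have hcard : ((W \ P).card : ℝ) + (P.card : ℝ) = (W.card : ℝ) := by
    exact_mod_cast Finset.card_sdiff_add_card_eq_card hPW
  have hce : (W.card : ℝ) * (⨅ Q : PeriodicConfiguration 3, Q.energyPerParticle lennardJones) =
      ((W \ P).card : ℝ) * (⨅ Q : PeriodicConfiguration 3, Q.energyPerParticle lennardJones) +
        (P.card : ℝ) * (⨅ Q : PeriodicConfiguration 3, Q.energyPerParticle lennardJones) := by
    rw [← hcard]
    ring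
  linarith

/-- **SUPERADDITIVITY OVER A DISJOINT FAMILY** (injective grade): for distinct points, an index set `W` and pairwise disjoint
`P_j ⊆ W` (`j ∈ s`):  `Σ_j X(y|P_j) − Σ_j N(P_j) ≤ X(y|W)`. -/
theorem windowExcess_superadditive {N : ℕ} {y : Fin N → EuclideanSpace ℝ (Fin 3)} (hy : Function.Injective y)
    {ι : Type*} (P : ι → Finset (Fin N)) (s : Finset ι) (W : Finset (Fin N)) (hPW : ∀ j ∈ s, P j ⊆ W)
    (hdisj : ∀ j ∈ s, ∀ j' ∈ s, j ≠ j' → Disjoint (P j) (P j')) :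
    ∑ j ∈ s, ((1 / 2) * ∑ i ∈ P j, ∑ k ∈ (P j).erase i, lennardJones (dist (y i) (y k)) -
        ((P j).card : ℝ) * (⨅ Q : PeriodicConfiguration 3, Q.energyPerParticle lennardJones)) -
      ∑ j ∈ s, ∑ i ∈ P j, ∑ k ∈ (P j)ᶜ, max 0 (-lennardJones (dist (y i) (y k))) ≤
    (1 / 2) * ∑ i ∈ W, ∑ k ∈ W.erase i, lennardJones (dist (y i) (y k)) -
      (W.card : ℝ) * (⨅ Q : PeriodicConfiguration 3, Q.energyPerParticle lennardJones) := by
  classical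
  induction s using Finset.induction_on generalizing W with
  | empty =>
    simp only [Finset.sum_empty, sub_zero]
    exact windowExcess_nonneg hy W
  | @insert j s hj ih =>
    rw [Finset.sum_insert hj, Finset.sum_insert hj]
    have hPjW : P j ⊆ W := hPW j (Finset.mem_insert_self j s)
    have hPW' : ∀ j' ∈ s, P j' ⊆ W \ P j := by
      intro j' hj'
      have hne : j' ≠ j := fun h => hj (h ▸ hj')
      exact Finset.subset_sdiff.2 ⟨hPW j' (Finset.mem_insert_of_mem hj'),
        hdisj j' (Finset.mem_insert_of_mem hj') j (Finset.mem_insert_self j s) hne⟩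
    have hdisj' : ∀ j₁ ∈ s, ∀ j₂ ∈ s, j₁ ≠ j₂ → Disjoint (P j₁) (P j₂) := fun j₁ h₁ j₂ h₂ hne =>
      hdisj j₁ (Finset.mem_insert_of_mem h₁) j₂ (Finset.mem_insert_of_mem h₂) hne
    have ih' := ih (W \ P j) hPW' hdisj'
    have hstep := windowExcess_split y hPjW
    linarith

/-! ## §3 GS grade: sub-balls of a ground-state window -/

/-- **GS sub-ball superadditivity**: `∃ D, ∀ r ≥ 9`, every Lennard-Jones ground state `y`, every index set `W` and every finite set of
centres `s` whose `r`-balls are pairwise disjoint index sets inside `W`: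
`Σ_{q∈s} X(y|B(q,r)) − #s·D·r² ≤ X(y|W)` — §2 with the tree's attractive cross ceiling `crossNeg_le` (p797612). -/
theorem gsSubBalls_superadditive : ∃ D : ℝ, ∀ r : ℝ, 9 ≤ r →
    ∀ (N : ℕ) (y : Fin N → EuclideanSpace ℝ (Fin 3)), IsGroundState lennardJones y →
      ∀ (W : Finset (Fin N)) (s : Finset (EuclideanSpace ℝ (Fin 3))),
        (∀ q ∈ s, (Finset.univ.filter fun i : Fin N => dist (y i) q ≤ r) ⊆ W) →
        (∀ q ∈ s, ∀ q' ∈ s, q ≠ q' →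
          Disjoint (Finset.univ.filter fun i : Fin N => dist (y i) q ≤ r) (Finset.univ.filter fun i : Fin N => dist (y i) q' ≤ r)) →
        ∑ q ∈ s, ((1 / 2) * ∑ i ∈ (Finset.univ.filter fun i : Fin N => dist (y i) q ≤ r),
              ∑ k ∈ (Finset.univ.filter fun i : Fin N => dist (y i) q ≤ r).erase i, lennardJones (dist (y i) (y k)) -
            ((Finset.univ.filter fun i : Fin N => dist (y i) q ≤ r).card : ℝ) *
              (⨅ Q : PeriodicConfiguration 3, Q.energyPerParticle lennardJones)) -
          (s.card : ℝ) * (D * r ^ 2) ≤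
        (1 / 2) * ∑ i ∈ W, ∑ k ∈ W.erase i, lennardJones (dist (y i) (y k)) -
          (W.card : ℝ) * (⨅ Q : PeriodicConfiguration 3, Q.energyPerParticle lennardJones) := by
  obtain ⟨D, hD⟩ := ContactSaturationLadderWindowCeiling.crossNeg_le
  refine ⟨D, fun r hr N y hGS W s hW hdisj => ?_⟩
  have hsup := windowExcess_superadditive hGS.1 (fun q : EuclideanSpace ℝ (Fin 3) =>
    Finset.univ.filter fun i : Fin N => dist (y i) q ≤ r) s W hW hdisj
  beta_reduce at hsup
  have hN : ∑ q ∈ s, ∑ i ∈ (Finset.univ.filter fun i : Fin N => dist (y i) q ≤ r),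
      ∑ k ∈ (Finset.univ.filter fun i : Fin N => dist (y i) q ≤ r)ᶜ, max 0 (-lennardJones (dist (y i) (y k))) ≤
      (s.card : ℝ) * (D * r ^ 2) := by
    calc ∑ q ∈ s, ∑ i ∈ (Finset.univ.filter fun i : Fin N => dist (y i) q ≤ r),
          ∑ k ∈ (Finset.univ.filter fun i : Fin N => dist (y i) q ≤ r)ᶜ, max 0 (-lennardJones (dist (y i) (y k)))
        ≤ ∑ q ∈ s, D * r ^ 2 := Finset.sum_le_sum fun q _ => hD r hr N y hGS q
      _ = (s.card : ℝ) * (D * r ^ 2) := by rw [Finset.sum_const, nsmul_eq_mul]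
  linarith

/-! ## §4 GS grade: virial-unbalanced sub-balls pay -/

/-- **Unbalanced sub-balls pay** (GS grade; dilation charge + localisation): for every `η > 0` there are `c > 0` and `D` such that
for `r ≥ 9`, every Lennard-Jones ground state `y`, every index set `W` and every finite set of centres `s` whose `r`-balls are pairwise
disjoint index sets inside `W` and are `η`-UNBALANCED (`η·#B(q,r) ≤ |S₁₂(B(q,r)) − S₆(B(q,r))|`):
`c·Σ_{q∈s} #B(q,r) − #s·D·r² ≤ X(y|W)`.  (`c = η²·δ¹²/6000`, `δ` the uniform minimal distance of ground states.) -/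
theorem gsUnbalancedBalls_pay : ∀ η : ℝ, 0 < η → ∃ c : ℝ, 0 < c ∧ ∃ D : ℝ, ∀ r : ℝ, 9 ≤ r →
    ∀ (N : ℕ) (y : Fin N → EuclideanSpace ℝ (Fin 3)), IsGroundState lennardJones y →
      ∀ (W : Finset (Fin N)) (s : Finset (EuclideanSpace ℝ (Fin 3))),
        (∀ q ∈ s, (Finset.univ.filter fun i : Fin N => dist (y i) q ≤ r) ⊆ W) →
        (∀ q ∈ s, ∀ q' ∈ s, q ≠ q' →
          Disjoint (Finset.univ.filter fun i : Fin N => dist (y i) q ≤ r) (Finset.univ.filter fun i : Fin N => dist (y i) q' ≤ r)) →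
        (∀ q ∈ s, η * ((Finset.univ.filter fun i : Fin N => dist (y i) q ≤ r).card : ℝ) ≤
          |(∑ i ∈ (Finset.univ.filter fun i : Fin N => dist (y i) q ≤ r),
                ∑ k ∈ (Finset.univ.filter fun i : Fin N => dist (y i) q ≤ r).erase i, (dist (y i) (y k))⁻¹ ^ 12) -
              ∑ i ∈ (Finset.univ.filter fun i : Fin N => dist (y i) q ≤ r),
                ∑ k ∈ (Finset.univ.filter fun i : Fin N => dist (y i) q ≤ r).erase i, (dist (y i) (y k))⁻¹ ^ 6|) →
        c * ∑ q ∈ s, ((Finset.univ.filter fun i : Fin N => dist (y i) q ≤ r).card : ℝ) - (s.card : ℝ) * (D * r ^ 2) ≤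
          (1 / 2) * ∑ i ∈ W, ∑ k ∈ W.erase i, lennardJones (dist (y i) (y k)) -
            (W.card : ℝ) * (⨅ Q : PeriodicConfiguration 3, Q.energyPerParticle lennardJones) := by
  intro η hη
  obtain ⟨δ, hδ, hsepGS⟩ := LennardJonesMinimalDistance_holds
  obtain ⟨D, hD⟩ := gsSubBalls_superadditive
  refine ⟨η ^ 2 / (6000 * δ⁻¹ ^ 12), by positivity, D, fun r hr N y hGS W s hW hdisj hunb => ?_⟩
  have hy : Function.Injective y := hGS.1
  have hsep : ∀ k l : Fin N, k ≠ l → δ ≤ dist (y k) (y l) := hsepGS N y hGS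
  have hsup := hD r hr N y hGS W s hW hdisj
  -- per ball: `c·#B ≤ X(y|B)`
  have hball : ∀ q ∈ s, η ^ 2 / (6000 * δ⁻¹ ^ 12) * ((Finset.univ.filter fun i : Fin N => dist (y i) q ≤ r).card : ℝ) ≤
      (1 / 2) * ∑ i ∈ (Finset.univ.filter fun i : Fin N => dist (y i) q ≤ r),
          ∑ k ∈ (Finset.univ.filter fun i : Fin N => dist (y i) q ≤ r).erase i, lennardJones (dist (y i) (y k)) -
        ((Finset.univ.filter fun i : Fin N => dist (y i) q ≤ r).card : ℝ) *
          (⨅ Q : PeriodicConfiguration 3, Q.energyPerParticle lennardJones) := by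
    intro q hq
    have hV := virial_sq_le_of_separated hy (Finset.univ.filter fun i : Fin N => dist (y i) q ≤ r) hδ hsep
    have hX := windowExcess_nonneg hy (Finset.univ.filter fun i : Fin N => dist (y i) q ≤ r)
    have hu := hunb q hq
    set B : Finset (Fin N) := Finset.univ.filter fun i : Fin N => dist (y i) q ≤ r with hB
    set X : ℝ := (1 / 2) * ∑ i ∈ B, ∑ k ∈ B.erase i, lennardJones (dist (y i) (y k)) -
      (B.card : ℝ) * (⨅ Q : PeriodicConfiguration 3, Q.energyPerParticle lennardJones) with hXdef
    set V : ℝ := (∑ i ∈ B, ∑ k ∈ B.erase i, (dist (y i) (y k))⁻¹ ^ 12) -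
      ∑ i ∈ B, ∑ k ∈ B.erase i, (dist (y i) (y k))⁻¹ ^ 6 with hVdef
    have hK0 : (0 : ℝ) < 6000 * δ⁻¹ ^ 12 := by positivity
    have hm0 : (0 : ℝ) ≤ η * (B.card : ℝ) := by positivity
    -- `(η·#B)² ≤ V² ≤ 6000 δ⁻¹² · #B · X`
    have h1 : (η * (B.card : ℝ)) ^ 2 ≤ V ^ 2 := by
      calc (η * (B.card : ℝ)) ^ 2 ≤ |V| ^ 2 := pow_le_pow_left₀ hm0 hu 2
        _ = V ^ 2 := sq_abs V
    have h2 : η ^ 2 * (B.card : ℝ) * (B.card : ℝ) ≤ (6000 * δ⁻¹ ^ 12) * X * (B.card : ℝ) := by nlinarith [h1, hV]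
    by_cases hcard : (B.card : ℝ) = 0
    · rw [hcard, mul_zero]
      exact hX
    · have hcpos : 0 < (B.card : ℝ) := lt_of_le_of_ne (Nat.cast_nonneg _) (Ne.symm hcard)
      have h3 : η ^ 2 * (B.card : ℝ) ≤ (6000 * δ⁻¹ ^ 12) * X := le_of_mul_le_mul_right h2 hcpos
      rw [div_mul_eq_mul_div, div_le_iff₀ hK0]
      linarith
  have hsum : η ^ 2 / (6000 * δ⁻¹ ^ 12) * ∑ q ∈ s, ((Finset.univ.filter fun i : Fin N => dist (y i) q ≤ r).card : ℝ) ≤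
      ∑ q ∈ s, ((1 / 2) * ∑ i ∈ (Finset.univ.filter fun i : Fin N => dist (y i) q ≤ r),
          ∑ k ∈ (Finset.univ.filter fun i : Fin N => dist (y i) q ≤ r).erase i, lennardJones (dist (y i) (y k)) -
        ((Finset.univ.filter fun i : Fin N => dist (y i) q ≤ r).card : ℝ) *
          (⨅ Q : PeriodicConfiguration 3, Q.energyPerParticle lennardJones)) := by
    rw [Finset.mul_sum]
    exact Finset.sum_le_sum hball
  linarith

end Summit.AtomisticToContinuum.Crystallization.Theorems.ContactSaturationLadderExcessSplit
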